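import Literature.AlgebraicGeometry.Motives.GrassmannianUniversalQuotientPullback
import Literature.AlgebraicGeometry.Motives.GrassmannianQuotientOfFreeModule
import Literature.AlgebraicGeometry.Modules.EpiIsoOfKernelSections
import Literature.AlgebraicGeometry.Modules.FiniteType
import Literature.AlgebraicGeometry.Modules.IsoOfAffineCover
import HarnessLib

/-!
# A rank-`k` quotient of `𝒪_T ⊗ M` is the pull-back of the universal quotient along its classifying morphism

Topic `AlgebraicGeometry/Motives`; namespaces `Literature.AlgebraicGeometry.Modules` (§1) and `….Motives.Grassmannian` (§2).
THEOREMS ONLY (no definition, no instance, no notation, no named fact, no `sorry`).  Closing brick (γ) of the cell's (h4) (Q3)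
«universal quotient on `grassmannianScheme M k`»: with ★ `existsUnique_hom_of_epi_freeModule` (B-p21 (g16): every rank-`k` epi
quotient `φ : 𝒪_T^{(J)} ↠ Q` HAS a unique classifying morphism `f`) and ★ FILE D `GrassmannianUniversalQuotientPullback` (every `f` classifies
`f^*(𝒬, q)`), we prove that the classifying morphism RECOVERS THE QUOTIENT: `Q ≅ f^*𝒬` under `𝒪_T^{(J)}` — so that
«`Hom(T, Grass_k(M)) ≃ {rank-k quotients of 𝒪_T ⊗ M} / ≅`» [GortzWedhorn2020, (8.4) (pp. 213–215)].

* §1 (any scheme `T`, free module `𝒪_T^{(J)} = freeModule T J` with tautological sections `ε_j`, ★ `GrassmannianUniversalQuotient`):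
  `map_freeSectionOn`; **`exists_hom_freeModule_app_eq`** — a morphism `ψ : 𝒪_T^{(J)} ⟶ N` with prescribed `ψ(ε_j) = s_j` (Mathlib
  `SheafOfModules.freeHomEquiv`); **`sectionsMap_app_freeSectionOn_eq`** — the sections map `θ_V(N, ψ ε)` of ★ `GrassmannianClassifyQuotient`
  factors as `ψ_V ∘ θ_V(𝒪^{(J)}, ε)`; `sectionsMap_freeModule_surjective` (`J` finite, ★ `freeModuleFrame`); `app_eq_zero_iff_of_ker_sectionsMap_eq`
  — equal kernels of the sections maps ⇒ equal sectionwise kernels of `ψ`, `ψ′`;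
* §2 for `f : T ⟶ grassmannianScheme M k`: `exists_epi_freeModule_pullback_universalQuotient` — the quotient map `𝒪_T^{(J)} ↠ f^*𝒬`,
  `ε_j ↦ η(q_j)`, exists and is epi (★ FILE D surjectivity on the affines inside `f⁻¹U_I`, ★ `epi_of_app_surjective_of_cover`);
  **`exists_iso_pullback_universalQuotient`** — if `φ : 𝒪_T^{(J)} ↠ Q` is classified by `f` then `∃ e : Q ≅ f^*𝒬, φ ≫ e.hom = ψ`
  (★ `Modules.exists_iso_comp_eq_of_app_iff`); **`exists_hom_iso_pullback_universalQuotient`** — every rank-`k` epi quotient of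
  `𝒪_T^{(J)}` is isomorphic under `𝒪_T^{(J)}` to `f^*𝒬` for some `f`.

[GortzWedhorn2020, (8.4) (pp. 213–215)]; [Hartshorne1977, II §5 (p. 109), II Prop. 5.6 (p. 113)]; [StacksProject, Tag 089R / 089T].
Cell `hodgecm-mathlib` (D-0151), count-neutral Mathlib-side capital; nothing here is about HC — HC_CM is proved only modulo the 7 printed
citations until rung 0 closes.
-/

noncomputable section
-- `TopCat.Presheaf`/`Scheme.Modules` are not reducible (as in Mathlib's `AlgebraicGeometry/Modules/Tilde.lean`).
set_option backward.isDefEq.respectTransparency false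

open CategoryTheory Opposite TensorProduct TopologicalSpace AlgebraicGeometry Limits
open Literature.AlgebraicGeometry.Motives

universe u

/-! ## §1 Morphisms out of the free module `𝒪_T^{(J)}` and their sections maps -/

namespace Literature.AlgebraicGeometry.Modules

open Literature.AlgebraicGeometry.Motives.Grassmannian

variable {T : Scheme.{u}} {J : Type u}

/-- The tautological sections restrict to the tautological sections: `ε_j|_U ↦ ε_j|_V`. [cite: Hartshorne1977, II §5 (p. 109)] -/
theorem map_freeSectionOn {U V : T.Opens} (i : V ⟶ U) (j : J) :
    (freeModule T J).presheaf.map i.op (freeSectionOn T j U) = freeSectionOn T j V :=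
  PresheafOfModules.sections_property (SheafOfModules.freeSection (R := T.ringCatSheaf) j) i.op

/-- **Morphisms out of `𝒪_T^{(J)}` with prescribed images of the `ε_j`**: for global sections `s_j ∈ Γ(N, T)` there is a
morphism `ψ : 𝒪_T^{(J)} ⟶ N` with `ψ(ε_j|_V) = s_j|_V` on every open `V` (Mathlib `SheafOfModules.freeHomEquiv` on the compatible
families `(s_j|_V)_V`). [cite: Hartshorne1977, II §5 (p. 109)] -/
theorem exists_hom_freeModule_app_eq (N : T.Modules) (s : J → Γ(N, ⊤)) :
    ∃ ψ : freeModule T J ⟶ N, ∀ (j : J) (V : T.Opens),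
      ψ.app V (freeSectionOn T j V) = N.presheaf.map (homOfLE (le_top : V ≤ ⊤)).op (s j) := by
  let fam : J → N.sections := fun j =>
    PresheafOfModules.sectionsMk (M := N.val) (fun V => N.presheaf.map (homOfLE (le_top : V.unop ≤ ⊤)).op (s j))
      fun V V' i => by
        change (N.presheaf.map _ ≫ N.presheaf.map i) _ = _
        rw [← Functor.map_comp]
        rfl
  refine ⟨N.freeHomEquiv.symm fam, fun j V => ?_⟩
  exact congrArg (fun t : N.sections => t.eval (op V))
    (SheafOfModules.sectionsMap_freeHomEquiv_symm_freeSection (M := N) fam j)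

variable {M : Type u} [AddCommGroup M] (b : Module.Basis J ℤ M) (N : T.Modules) (ψ : freeModule T J ⟶ N)

/-- **The sections map of `(N, ψ(ε_j))` factors through `ψ`**: `θ_V(N, ψ ε) = ψ_V ∘ θ_V(𝒪^{(J)}, ε)`.
[cite: GortzWedhorn2020, (8.4) (pp. 213–215)] [cite: Hartshorne1977, II §5 (p. 109)] -/
theorem sectionsMap_app_freeSectionOn_eq (V : T.Opens) (z : Γ(T, V) ⊗[ℤ] M) :
    sectionsMap b N (fun j => ψ.app ⊤ (freeSectionOn T j ⊤)) V z =
      ψ.app V (sectionsMap b (freeModule T J) (fun j => freeSectionOn T j ⊤) V z) := by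
  have key : sectionsMap b N (fun j => ψ.app ⊤ (freeSectionOn T j ⊤)) V =
      appLinear ψ V ∘ₗ sectionsMap b (freeModule T J) (fun j => freeSectionOn T j ⊤) V := by
    refine TensorProduct.AlgebraTensorModule.ext fun a m => ?_
    rw [LinearMap.comp_apply, sectionsMap_tmul b N _ V a m, sectionsMap_tmul b (freeModule T J) _ V a m,
      map_smul (appLinear ψ V)]
    congr 1
    -- the case `1 ⊗ m`: two `ℤ`-linear maps `M → Γ(N, V)` agreeing on the basis `b`
    let f₁ : M →ₗ[ℤ] Γ(N, V) :=
      (sectionsMap b N (fun j => ψ.app ⊤ (freeSectionOn T j ⊤)) V).restrictScalars ℤ ∘ₗ TensorProduct.mk ℤ Γ(T, V) M 1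
    let f₂ : M →ₗ[ℤ] Γ(N, V) :=
      (appLinear ψ V ∘ₗ sectionsMap b (freeModule T J) (fun j => freeSectionOn T j ⊤) V).restrictScalars ℤ ∘ₗ
        TensorProduct.mk ℤ Γ(T, V) M 1
    have hf : f₁ = f₂ := by
      refine b.ext fun j => ?_
      change sectionsMap b N (fun j => ψ.app ⊤ (freeSectionOn T j ⊤)) V ((1 : Γ(T, V)) ⊗ₜ[ℤ] b j) =
        appLinear ψ V (sectionsMap b (freeModule T J) (fun j => freeSectionOn T j ⊤) V ((1 : Γ(T, V)) ⊗ₜ[ℤ] b j))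
      rw [sectionsMap_one_tmul, sectionsMap_one_tmul, appLinear_apply, map_freeSectionOn, ← app_presheaf_map,
        map_freeSectionOn]
    exact LinearMap.congr_fun hf m
  rw [key, LinearMap.comp_apply, appLinear_apply]

/-- **The sections map of the free module is surjective** (`J` finite): every section of `𝒪_T^{(J)}` over `V` is
`Σ_j c_j ε_j|_V = θ_V(Σ_j c_j ⊗ b_j)` (★ `freeModuleFrame`, ★ `basisSection_freeModuleFrame`, ★ `eq_sum_coord_smul`).
[cite: Hartshorne1977, II §5 (p. 109)] -/
theorem sectionsMap_freeModule_surjective [Fintype J] (V : T.Opens) :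
    Function.Surjective (sectionsMap b (freeModule T J) (fun j => freeSectionOn T j ⊤) V) := by
  intro x
  refine ⟨∑ j, coord (freeModuleFrame T J V) (𝟙 V) x j ⊗ₜ[ℤ] b j, ?_⟩
  rw [map_sum]
  conv_rhs => rw [eq_sum_coord_smul (freeModuleFrame T J V) (𝟙 V) x]
  refine Finset.sum_congr rfl fun j _ => ?_
  rw [sectionsMap_tmul, sectionsMap_one_tmul, map_freeSectionOn, basisSection_freeModuleFrame, op_id,
    (freeModule T J).presheaf.map_id]
  rfl

/-- **Sectionwise kernels of `ψ` vs kernels of the sections maps**: if two morphisms `ψ : 𝒪^{(J)} ⟶ N`, `ψ′ : 𝒪^{(J)} ⟶ N′`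
have sections maps (for the sections `ψ(ε_j)`, `ψ′(ε_j)`) with the same kernel over `V`, then `ψ_V x = 0 ↔ ψ′_V x = 0` for every
section `x` of `𝒪^{(J)}` over `V` (`J` finite). [cite: GortzWedhorn2020, (8.4) (pp. 213–215)] -/
theorem app_eq_zero_iff_of_ker_sectionsMap_eq [Fintype J] {N' : T.Modules} (ψ' : freeModule T J ⟶ N') (V : T.Opens)
    (h : LinearMap.ker (sectionsMap b N (fun j => ψ.app ⊤ (freeSectionOn T j ⊤)) V) =
      LinearMap.ker (sectionsMap b N' (fun j => ψ'.app ⊤ (freeSectionOn T j ⊤)) V))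
    (x : Γ(freeModule T J, V)) : ψ.app V x = 0 ↔ ψ'.app V x = 0 := by
  obtain ⟨z, rfl⟩ := sectionsMap_freeModule_surjective b V x
  rw [← sectionsMap_app_freeSectionOn_eq, ← sectionsMap_app_freeSectionOn_eq, ← LinearMap.mem_ker, ← LinearMap.mem_ker, h]

end Literature.AlgebraicGeometry.Modules

/-! ## §2 `Q ≅ f^*𝒬` for the classifying morphism `f` of `(Q, φ)` -/

namespace Literature.AlgebraicGeometry.Motives.Grassmannian

open Literature.AlgebraicGeometry.Modules

variable (k : ℕ) (M : Type u) [AddCommGroup M] {J : Type u} [Fintype J] (b : Module.Basis J ℤ M)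
  [(grassmannianSheaf M k).obj.IsRepresentable] {T : Scheme.{u}} (f : T ⟶ grassmannianScheme M k)

omit [Fintype J] in
/-- Affine opens of `T` inside some `f⁻¹U_I` cover `T`. [cite: StacksProject, Tag 089T] -/
theorem iSup_affineOpens_le_preimage_chart_eq_top :
    ⨆ W : {W : T.affineOpens // ∃ I : {I : Fin k → J // Function.Injective I},
        (W : T.Opens) ≤ f ⁻¹ᵁ ((chartOpenCover k M b).f I).opensRange}, (W.1 : T.Opens) = ⊤ := by
  refine top_le_iff.mp fun t _ => ?_
  obtain ⟨I, hI⟩ := exists_mem_opensRange_chartι k M b (f t)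
  have ht : t ∈ f ⁻¹ᵁ ((chartOpenCover k M b).f I).opensRange := hI
  obtain ⟨W, hW, htW, hWle⟩ := Opens.isBasis_iff_nbhd.mp T.isBasis_affineOpens ht
  exact Opens.mem_iSup.mpr ⟨⟨⟨W, hW⟩, I, hWle⟩, htW⟩

omit [Fintype J] in
/-- **The pulled-back quotient map `𝒪_T^{(J)} ↠ f^*𝒬`, `ε_j ↦ η(q_j)`, exists and is an epimorphism** (surjective on the
affine opens inside the `f⁻¹U_I`, ★ `sectionsMap_pullback_universalQuotient_surjective_of_le`; ★ `epi_of_app_surjective_of_cover`).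
[cite: GortzWedhorn2020, (8.4) (pp. 213–215)] [cite: Hartshorne1977, II Prop. 5.6 (p. 113)] -/
theorem exists_epi_freeModule_pullback_universalQuotient :
    ∃ ψ : freeModule T J ⟶ (Scheme.Modules.pullback f).obj (universalQuotient k M b),
      (∀ (j : J) (V : T.Opens), ψ.app V (freeSectionOn T j V) =
        ((Scheme.Modules.pullback f).obj (universalQuotient k M b)).presheaf.map (homOfLE (le_top : V ≤ ⊤)).op
          (unitSection f (universalQuotient k M b) ⊤ (universalQuotientSection k M b j))) ∧ Epi ψ := by
  obtain ⟨ψ, hψ⟩ := exists_hom_freeModule_app_eq ((Scheme.Modules.pullback f).obj (universalQuotient k M b))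
    fun j => unitSection f (universalQuotient k M b) ⊤ (universalQuotientSection k M b j)
  have hψtop : (fun j => ψ.app ⊤ (freeSectionOn T j ⊤)) =
      fun j => unitSection f (universalQuotient k M b) ⊤ (universalQuotientSection k M b j) := by
    funext j
    rw [hψ j ⊤, show homOfLE (le_top : (⊤ : T.Opens) ≤ ⊤) = 𝟙 _ from Subsingleton.elim _ _, op_id,
      ((Scheme.Modules.pullback f).obj (universalQuotient k M b)).presheaf.map_id]
    rfl
  refine ⟨ψ, hψ, epi_of_app_surjective_of_cover ψ (isAffineLocalizing_pullback_universalQuotient k M b f)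
    (fun W : {W : T.affineOpens // ∃ I : {I : Fin k → J // Function.Injective I},
      (W : T.Opens) ≤ f ⁻¹ᵁ ((chartOpenCover k M b).f I).opensRange} => (W.1 : T.Opens))
    (fun W => W.1.2) (iSup_affineOpens_le_preimage_chart_eq_top k M b f) fun W => ?_⟩
  obtain ⟨I, hle⟩ := W.2
  intro y
  obtain ⟨z, hz⟩ := sectionsMap_pullback_universalQuotient_surjective_of_le k M b f I W.1.2 hle y
  refine ⟨sectionsMap b (freeModule T J) (fun j => freeSectionOn T j ⊤) W.1 z, ?_⟩
  rw [← sectionsMap_app_freeSectionOn_eq, hψtop, hz]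

/-- **A QUOTIENT CLASSIFIED BY `f` IS THE PULL-BACK OF THE UNIVERSAL QUOTIENT ALONG `f`**: if the epimorphism
`φ : 𝒪_T^{(J)} = 𝒪_T ⊗ M ↠ Q` is classified by `f : T ⟶ grassmannianScheme M k` (the property of ★ `existsUnique_hom_of_epi_freeModule`:
`evalAffine V (pointsEquiv f) = ker θ_V(Q, φ ε)` on every affine `V`), then `Q ≅ f^*𝒬` under `𝒪_T^{(J)}`: there are the quotient map
`ψ : 𝒪_T^{(J)} ↠ f^*𝒬`, `ε_j ↦ η(q_j)`, and an isomorphism `e : Q ≅ f^*𝒬` with `φ ≫ e = ψ` (★ FILE D `ker_sectionsMap_pullback_universalQuotient`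
gives `ker θ_V(f^*𝒬, η q) = (pointsEquiv f)|_V` too; ★ `exists_iso_comp_eq_of_app_iff`).  With ★ `existsUnique_hom_of_epi_freeModule` this is
the universal property «`Hom(T, Grass_k(M)) ≃ {rank-k quotients of 𝒪_T ⊗ M} / ≅`» of [GortzWedhorn2020, (8.4)].
[cite: GortzWedhorn2020, (8.4) (pp. 213–215)] [cite: StacksProject, Tag 089R] -/
theorem exists_iso_pullback_universalQuotient (Q : T.Modules) (φ : freeModule T J ⟶ Q) [Epi φ]
    (hf : ∀ V : T.affineOpens, (evalAffine V.2 (pointsEquiv M k T f)).toSubmodule =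
      LinearMap.ker (sectionsMap b Q (fun j => φ.app ⊤ (freeSectionOn T j ⊤)) V)) :
    ∃ (ψ : freeModule T J ⟶ (Scheme.Modules.pullback f).obj (universalQuotient k M b))
      (e : Q ≅ (Scheme.Modules.pullback f).obj (universalQuotient k M b)),
      (∀ (j : J) (V : T.Opens), ψ.app V (freeSectionOn T j V) =
        ((Scheme.Modules.pullback f).obj (universalQuotient k M b)).presheaf.map (homOfLE (le_top : V ≤ ⊤)).op
          (unitSection f (universalQuotient k M b) ⊤ (universalQuotientSection k M b j))) ∧
      Epi ψ ∧ φ ≫ e.hom = ψ := by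
  obtain ⟨ψ, hψ, hepi⟩ := exists_epi_freeModule_pullback_universalQuotient k M b f
  have hψtop : (fun j => ψ.app ⊤ (freeSectionOn T j ⊤)) =
      fun j => unitSection f (universalQuotient k M b) ⊤ (universalQuotientSection k M b j) := by
    funext j
    rw [hψ j ⊤, show homOfLE (le_top : (⊤ : T.Opens) ≤ ⊤) = 𝟙 _ from Subsingleton.elim _ _, op_id,
      ((Scheme.Modules.pullback f).obj (universalQuotient k M b)).presheaf.map_id]
    rfl
  haveI := hepi
  obtain ⟨e, he⟩ := exists_iso_comp_eq_of_app_iff φ ψ fun V hV s =>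
    app_eq_zero_iff_of_ker_sectionsMap_eq b Q φ ψ V
      (by rw [← hf ⟨V, hV⟩, hψtop, ker_sectionsMap_pullback_universalQuotient k M b f hV]) s
  exact ⟨ψ, e, hψ, hepi, he⟩

/-- **UNIVERSAL PROPERTY OF THE GRASSMANNIAN, OBJECT FORM**: every epimorphism `φ : 𝒪_T^{(J)} = 𝒪_T ⊗ M ↠ Q` onto a module of
rank `k` is, up to a unique-under-`𝒪^{(J)}` isomorphism, the pull-back `𝒪_T^{(J)} ↠ f^*𝒬` of the universal quotient along a (unique,
★ `existsUnique_hom_of_epi_freeModule`) morphism `f : T ⟶ grassmannianScheme M k`. [cite: GortzWedhorn2020, (8.4) (pp. 213–215)]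
[cite: StacksProject, Tag 089R] -/
theorem exists_hom_iso_pullback_universalQuotient (Q : T.Modules) (φ : freeModule T J ⟶ Q) [Epi φ] (hQ : HasRank Q k) :
    ∃ (g : T ⟶ grassmannianScheme M k)
      (ψ : freeModule T J ⟶ (Scheme.Modules.pullback g).obj (universalQuotient k M b))
      (e : Q ≅ (Scheme.Modules.pullback g).obj (universalQuotient k M b)),
      (∀ (j : J) (V : T.Opens), ψ.app V (freeSectionOn T j V) =
        ((Scheme.Modules.pullback g).obj (universalQuotient k M b)).presheaf.map (homOfLE (le_top : V ≤ ⊤)).op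
          (unitSection g (universalQuotient k M b) ⊤ (universalQuotientSection k M b j))) ∧
      Epi ψ ∧ φ ≫ e.hom = ψ := by
  obtain ⟨g, hg, -⟩ := existsUnique_hom_of_epi_freeModule M k b Q φ hQ
  exact ⟨g, exists_iso_pullback_universalQuotient k M b g Q φ hg⟩

end Literature.AlgebraicGeometry.Motives.Grassmannian

end
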